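import Literature.Dynamics.ConleyIndex.WazewskiPrinciple
import Mathlib.Analysis.Calculus.Deriv.MeanValue
import HarnessLib

/-!
# Regular polyfacial sets of a semiflow: exit set and Ważewski's retract principle

Topic `Literature/Dynamics/ConleyIndex`; continues `Semiflow.lean` / `WazewskiPrinciple.lean`.
Ważewski's original blocks are *regular polyfacial sets*: sets cut out by finitely many level
sets of functions which are strictly monotone along trajectories where they vanish
[Wazewski1947; HaleMagalhaesOliva2002, App. A, p. 244: "sets whose boundaries consist, piecewise,
of level surfaces of special Lyapunov-like functions"].  The textbook form is Hartman's
"`(u, v)`-subsets" [Hartman2002, Ch. X §3, (3.3)–(3.6), p. 280]: OPEN sets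
`Ω⁰ = {u_j < 0, v_k < 0}` whose trajectory derivatives satisfy `u̇_α > 0` on the face `U_α`
and `v̇_β < 0` on the face `V_β`, with egress set `⋃ U_α ∖ ⋃ V_β` (Lemma 3.1) and Ważewski's
theorem for them (Thm. 3.1).  This file formalises the CLOSED-set variant matching
`IsIsolatingBlock` — `B = {x | ∀ i, 0 ≤ h i x}`, one family of faces `h i` whose derivative
along the flow `d i` has either sign — for an abstract continuous semiflow `φ : ℝ → X → X`,
which is how an ODE prover meets it after the chain rule (`d i = Dh i · F`):

* `faceSet h = {x | ∀ i, 0 ≤ h i x}` for face functions `h : ι → X → ℝ`;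
* `IsRegularPolyfacial φ h d` (hypothesis structure): `φ` is a continuous semiflow, `h i` and
  `d i` are continuous, `t ↦ h i (φ t x)` has derivative `d i (φ t x)` at every `t > 0` (for an
  ODE `ẋ = F(x)`, `d i = Dh i · F`), and on `faceSet h` every ACTIVE face (`h i x = 0`) is
  transversal: `d i x ≠ 0`;
* consequences (all proved, `ι` finite where stated): local strict monotonicity of `h i` along
  orbits near a point where `d i ≠ 0` (mean value theorem), the forward / backward behaviour at a
  point according to the signs of the active `d i`, and
  **`IsRegularPolyfacial.immediateExitSet_eq`**: Conley's exit set of `B = faceSet h` is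
  `B⁻ = {x ∈ B | ∃ i, h i x = 0 ∧ d i x < 0}`, which is CLOSED
  (`isClosed_immediateExitSet`); hence **`IsRegularPolyfacial.exists_forall_mem_of_not_retract`**:
  if there is no retraction of `B` onto that explicit set, some forward orbit stays in `B`
  (Ważewski's retract principle, via `IsSemiflow.exists_forall_mem_of_not_retract`).

The classification of `∂B` into strict egress / ingress / bounce-off points and the conclusion
`IsIsolatingBlock φ (faceSet h)` are in `PolyfacialBlock.lean`.
-/

open Set Filter
open scoped Topology

namespace Literature.Dynamics.ConleyIndex

variable {X : Type*} [TopologicalSpace X] {ι : Type*}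

/-- The **polyfacial set** cut out by the face functions `h i`: `{x | ∀ i, 0 ≤ h i x}` (the
closed counterpart of Hartman's `Ω⁰ = {u_j < 0, v_k < 0}`, (3.3)).
[cite: Hartman2002, Ch. X §3, (3.3), p. 280] -/
def faceSet (h : ι → X → ℝ) : Set X :=
  {x : X | ∀ i, 0 ≤ h i x}

omit [TopologicalSpace X] in
/-- Membership in `faceSet`. [folklore] -/
@[simp] theorem mem_faceSet_iff {h : ι → X → ℝ} {x : X} : x ∈ faceSet h ↔ ∀ i, 0 ≤ h i x :=
  Iff.rfl

/-- A polyfacial set with continuous faces is closed. [folklore] -/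
theorem isClosed_faceSet {h : ι → X → ℝ} (hh : ∀ i, Continuous (h i)) : IsClosed (faceSet h) := by
  have : faceSet h = ⋂ i, {x | 0 ≤ h i x} := by ext x; simp [faceSet]
  rw [this]
  exact isClosed_iInter fun i => isClosed_le continuous_const (hh i)

/-- The set where all faces are positive is open (finitely many faces). [folklore] -/
theorem isOpen_setOf_forall_face_pos [Finite ι] {h : ι → X → ℝ} (hh : ∀ i, Continuous (h i)) :
    IsOpen {x : X | ∀ i, 0 < h i x} := by
  have : {x : X | ∀ i, 0 < h i x} = ⋂ i, {x | 0 < h i x} := by ext x; simp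
  rw [this]
  exact isOpen_iInter_of_finite fun i => isOpen_lt continuous_const (hh i)

/-- Points where all faces are positive are interior points of the polyfacial set. [folklore] -/
theorem setOf_forall_face_pos_subset_interior [Finite ι] {h : ι → X → ℝ}
    (hh : ∀ i, Continuous (h i)) : {x : X | ∀ i, 0 < h i x} ⊆ interior (faceSet h) :=
  interior_maximal (fun _ hx i => (hx i).le) (isOpen_setOf_forall_face_pos hh)

/-- A boundary point of the polyfacial set lies in it and has an active face. [folklore] -/
theorem exists_face_eq_zero_of_mem_frontier [Finite ι] {h : ι → X → ℝ}
    (hh : ∀ i, Continuous (h i)) {x : X} (hx : x ∈ frontier (faceSet h)) :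
    x ∈ faceSet h ∧ ∃ i, h i x = 0 := by
  have hxB : x ∈ faceSet h := (isClosed_faceSet hh).frontier_subset hx
  refine ⟨hxB, ?_⟩
  by_contra hne
  push Not at hne
  have hpos : ∀ i, 0 < h i x := fun i => (hxB i).lt_of_ne' (hne i)
  exact hx.2 (setOf_forall_face_pos_subset_interior hh hpos)

/-- **Regular polyfacial data** for a semiflow (first-order / no-tangency case): `φ` is a
continuous semiflow; the faces `h i` and their derivatives along the flow `d i` are continuous;
`t ↦ h i (φ t x)` has derivative `d i (φ t x)` at every `t > 0` (Hartman's "trajectory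
derivative", (3.1)–(3.2)); and on the polyfacial set every active face is crossed transversally,
`h i x = 0 → d i x ≠ 0` (Hartman's (3.5)–(3.6), both signs allowed in one family).  Closed-set
variant of the `(u, v)`-subsets of [Hartman2002, Ch. X §3]; for the flow of a `C¹` vector field
`F` and `C¹` faces, `d i = Dh i · F`. [cite: Hartman2002, Ch. X §3, (3.3)–(3.6), p. 280] -/
structure IsRegularPolyfacial (φ : ℝ → X → X) (h d : ι → X → ℝ) : Prop where
  /-- `φ` is a continuous semiflow -/
  isSemiflow : IsSemiflow φ
  /-- the faces are continuous -/
  continuous_face : ∀ i, Continuous (h i)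
  /-- their derivatives along the flow are continuous -/
  continuous_deriv : ∀ i, Continuous (d i)
  /-- `d i` is the derivative of `h i` along orbits (at positive times) -/
  hasDerivAt : ∀ i x t, 0 < t → HasDerivAt (fun s => h i (φ s x)) (d i (φ t x)) t
  /-- active faces are transversal on the polyfacial set -/
  deriv_ne_zero : ∀ x ∈ faceSet h, ∀ i, h i x = 0 → d i x ≠ 0

namespace IsRegularPolyfacial

variable {φ : ℝ → X → X} {h d : ι → X → ℝ}

/-! ### Local strict monotonicity of a face along an orbit -/

/-- If `d i > 0` at the point `φ t₀ z` (`t₀ ≥ 0`) of an orbit, then `s ↦ h i (φ s z)` is strictly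
increasing on `[max 0 (t₀ - ε), t₀ + ε]` for some `ε > 0` (mean value theorem). [folklore] -/
theorem exists_strictMonoOn (hF : IsRegularPolyfacial φ h d) (i : ι) (z : X) {t₀ : ℝ}
    (ht₀ : 0 ≤ t₀) (hpos : 0 < d i (φ t₀ z)) :
    ∃ ε > 0, StrictMonoOn (fun s => h i (φ s z)) (Icc (max 0 (t₀ - ε)) (t₀ + ε)) := by
  have hc : ContinuousWithinAt (fun s => d i (φ s z)) (Ici 0) t₀ :=
    (hF.continuous_deriv i).continuousAt.comp_continuousWithinAt
      (hF.isSemiflow.continuousWithinAt_orbit z ht₀)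
  have hev : ∀ᶠ s in 𝓝[Ici (0 : ℝ)] t₀, 0 < d i (φ s z) := hc (isOpen_Ioi.mem_nhds hpos)
  rw [nhdsWithin, eventually_inf_principal, Metric.eventually_nhds_iff] at hev
  obtain ⟨ε, hε, hball⟩ := hev
  refine ⟨ε / 2, by positivity, strictMonoOn_of_deriv_pos (convex_Icc _ _) ?_ fun s hs => ?_⟩
  · exact (hF.continuous_face i).comp_continuousOn
      ((hF.isSemiflow.continuousOn_orbit z).mono fun s hs => (le_max_left _ _).trans hs.1)
  · rw [interior_Icc] at hs
    have hs0 : 0 < s := (le_max_left _ _).trans_lt hs.1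
    rw [(hF.hasDerivAt i z s hs0).deriv]
    refine hball ?_ hs0.le
    have h1 : t₀ - ε / 2 < s := (le_max_right _ _).trans_lt hs.1
    rw [Real.dist_eq, abs_lt]
    constructor <;> linarith [hs.2]

/-- If `d i < 0` at the point `φ t₀ z` (`t₀ ≥ 0`) of an orbit, then `s ↦ h i (φ s z)` is strictly
decreasing on `[max 0 (t₀ - ε), t₀ + ε]` for some `ε > 0`. [folklore] -/
theorem exists_strictAntiOn (hF : IsRegularPolyfacial φ h d) (i : ι) (z : X) {t₀ : ℝ}
    (ht₀ : 0 ≤ t₀) (hneg : d i (φ t₀ z) < 0) :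
    ∃ ε > 0, StrictAntiOn (fun s => h i (φ s z)) (Icc (max 0 (t₀ - ε)) (t₀ + ε)) := by
  have hc : ContinuousWithinAt (fun s => d i (φ s z)) (Ici 0) t₀ :=
    (hF.continuous_deriv i).continuousAt.comp_continuousWithinAt
      (hF.isSemiflow.continuousWithinAt_orbit z ht₀)
  have hev : ∀ᶠ s in 𝓝[Ici (0 : ℝ)] t₀, d i (φ s z) < 0 := hc (isOpen_Iio.mem_nhds hneg)
  rw [nhdsWithin, eventually_inf_principal, Metric.eventually_nhds_iff] at hev
  obtain ⟨ε, hε, hball⟩ := hev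
  refine ⟨ε / 2, by positivity, strictAntiOn_of_deriv_neg (convex_Icc _ _) ?_ fun s hs => ?_⟩
  · exact (hF.continuous_face i).comp_continuousOn
      ((hF.isSemiflow.continuousOn_orbit z).mono fun s hs => (le_max_left _ _).trans hs.1)
  · rw [interior_Icc] at hs
    have hs0 : 0 < s := (le_max_left _ _).trans_lt hs.1
    rw [(hF.hasDerivAt i z s hs0).deriv]
    refine hball ?_ hs0.le
    have h1 : t₀ - ε / 2 < s := (le_max_right _ _).trans_lt hs.1
    rw [Real.dist_eq, abs_lt]
    constructor <;> linarith [hs.2]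

/-! ### Behaviour just after time `0` -/

/-- An active face with `d i x > 0` becomes positive just after time `0`. [folklore] -/
theorem face_pos_of_deriv_pos (hF : IsRegularPolyfacial φ h d) {i : ι} {x : X} (hi : h i x = 0)
    (hd : 0 < d i x) : ∃ ε > 0, ∀ s ∈ Ioc 0 ε, 0 < h i (φ s x) := by
  have hd' : 0 < d i (φ 0 x) := by rwa [hF.isSemiflow.map_zero]
  obtain ⟨ε, hε, hmono⟩ := hF.exists_strictMonoOn i x le_rfl hd'
  rw [zero_sub, max_eq_left (by linarith : -ε ≤ 0), zero_add] at hmono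
  refine ⟨ε, hε, fun s hs => ?_⟩
  have := hmono (left_mem_Icc.2 hε.le) ⟨hs.1.le, hs.2⟩ hs.1
  simpa [hF.isSemiflow.map_zero, hi] using this

/-- An active face with `d i x < 0` becomes negative just after time `0`. [folklore] -/
theorem face_neg_of_deriv_neg (hF : IsRegularPolyfacial φ h d) {i : ι} {x : X} (hi : h i x = 0)
    (hd : d i x < 0) : ∃ ε > 0, ∀ s ∈ Ioc 0 ε, h i (φ s x) < 0 := by
  have hd' : d i (φ 0 x) < 0 := by rwa [hF.isSemiflow.map_zero]
  obtain ⟨ε, hε, hanti⟩ := hF.exists_strictAntiOn i x le_rfl hd'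
  rw [zero_sub, max_eq_left (by linarith : -ε ≤ 0), zero_add] at hanti
  refine ⟨ε, hε, fun s hs => ?_⟩
  have := hanti (left_mem_Icc.2 hε.le) ⟨hs.1.le, hs.2⟩ hs.1
  simpa [hF.isSemiflow.map_zero, hi] using this

/-- An inactive (positive) face stays positive just after time `0`. [folklore] -/
theorem face_pos_of_face_pos (hF : IsRegularPolyfacial φ h d) {i : ι} {x : X} (hi : 0 < h i x) :
    ∃ ε > 0, ∀ s ∈ Icc 0 ε, 0 < h i (φ s x) := by
  have hc : ContinuousWithinAt (fun s => h i (φ s x)) (Ici 0) 0 :=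
    (hF.continuous_face i).continuousAt.comp_continuousWithinAt
      (hF.isSemiflow.continuousWithinAt_orbit x le_rfl)
  have hi' : 0 < h i (φ 0 x) := by rwa [hF.isSemiflow.map_zero]
  have hev : ∀ᶠ s in 𝓝[Ici (0 : ℝ)] 0, 0 < h i (φ s x) := hc (isOpen_Ioi.mem_nhds hi')
  rw [nhdsWithin, eventually_inf_principal, Metric.eventually_nhds_iff] at hev
  obtain ⟨ε, hε, hball⟩ := hev
  refine ⟨ε / 2, by positivity, fun s hs => hball ?_ hs.1⟩
  rw [Real.dist_eq, sub_zero, abs_of_nonneg hs.1]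
  linarith [hs.2]

/-- **Exit through a face**: if some active face has `d i x < 0`, the orbit of `x` is outside
`faceSet h` just after time `0`. [folklore] -/
theorem forall_not_mem_of_deriv_neg (hF : IsRegularPolyfacial φ h d) {i : ι} {x : X}
    (hi : h i x = 0) (hd : d i x < 0) : ∃ ε > 0, ∀ s ∈ Ioc 0 ε, φ s x ∉ faceSet h := by
  obtain ⟨ε, hε, hneg⟩ := hF.face_neg_of_deriv_neg hi hd
  exact ⟨ε, hε, fun s hs hB => (not_le.2 (hneg s hs)) (hB i)⟩

/-- **Entrance**: if `x ∈ faceSet h` and every active face has `d i x > 0`, the orbit of `x` is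
in the interior of `faceSet h` just after time `0` (finitely many faces). [folklore] -/
theorem forall_mem_interior_of_deriv_pos [Finite ι] (hF : IsRegularPolyfacial φ h d) {x : X}
    (hx : x ∈ faceSet h) (hpos : ∀ i, h i x = 0 → 0 < d i x) :
    ∃ ε > 0, ∀ s ∈ Ioc 0 ε, φ s x ∈ interior (faceSet h) := by
  have hall : ∀ᶠ s in 𝓝[>] (0 : ℝ), ∀ i, 0 < h i (φ s x) := by
    refine eventually_all.2 fun i => ?_
    rcases (hx i).eq_or_lt with h0 | hlt
    · obtain ⟨ε, hε, hε'⟩ := hF.face_pos_of_deriv_pos h0.symm (hpos i h0.symm)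
      exact mem_of_superset (Ioc_mem_nhdsGT hε) hε'
    · obtain ⟨ε, hε, hε'⟩ := hF.face_pos_of_face_pos hlt
      exact mem_of_superset (Ioc_mem_nhdsGT hε) fun s hs => hε' s ⟨hs.1.le, hs.2⟩
  obtain ⟨u, hu, hsub⟩ := mem_nhdsGT_iff_exists_Ioc_subset.1 hall
  exact ⟨u, hu, fun s hs =>
    setOf_forall_face_pos_subset_interior hF.continuous_face (hsub hs)⟩

/-! ### Behaviour just before time `0` along a solution -/

section Backward

variable {σ : ℝ → X} {δ₁ δ₂ : ℝ} {x : X}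

omit [TopologicalSpace X] in
/-- A solution on `[-δ₁, δ₂]` is the orbit of its initial point `σ (-δ₁)`. [folklore] -/
theorem _root_.Literature.Dynamics.ConleyIndex.IsSolutionOn.eq_orbit_left
    (hσ : IsSolutionOn φ σ (Icc (-δ₁) δ₂)) (hδ : 0 ≤ δ₁ + δ₂) {s : ℝ} (hs : s ∈ Icc (-δ₁) δ₂) :
    σ s = φ (s + δ₁) (σ (-δ₁)) := by
  have h := hσ (t := -δ₁) ⟨le_rfl, by linarith⟩ (s := s + δ₁) (by linarith [hs.1])
    (by ring_nf; simpa [add_comm] using hs)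
  rw [← h]; ring_nf

/-- An active face with `d i x > 0` is negative just before time `0` along every solution
through `x`. [folklore] -/
theorem face_neg_before_of_deriv_pos (hF : IsRegularPolyfacial φ h d)
    (hσ : IsSolutionOn φ σ (Icc (-δ₁) δ₂)) (hδ₁ : 0 < δ₁) (hδ₂ : 0 ≤ δ₂) (hσ0 : σ 0 = x)
    {i : ι} (hi : h i x = 0) (hd : 0 < d i x) :
    ∃ ε ∈ Ioc 0 δ₁, ∀ s ∈ Ico (-ε) 0, h i (σ s) < 0 := by
  set z := σ (-δ₁) with hz
  have hx : φ δ₁ z = x := by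
    have := hσ.eq_orbit_left (by linarith) (s := 0) ⟨by linarith, hδ₂⟩
    rw [zero_add] at this; rw [← this, hσ0]
  obtain ⟨ε, hε, hmono⟩ := hF.exists_strictMonoOn i z hδ₁.le (by rwa [hx])
  refine ⟨min ε δ₁, ⟨lt_min hε hδ₁, min_le_right _ _⟩, fun s hs => ?_⟩
  have hs1 : -δ₁ ≤ s := by linarith [hs.1, min_le_right ε δ₁]
  rw [hσ.eq_orbit_left (by linarith) ⟨hs1, by linarith [hs.2]⟩]
  have hlt := hmono (a := s + δ₁) (b := δ₁) ⟨?_, by linarith [hs.2]⟩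
    ⟨max_le hδ₁.le (by linarith), by linarith⟩ (by linarith [hs.2])
  · simpa [hx, hi] using hlt
  · refine max_le (by linarith) ?_
    linarith [hs.1, min_le_left ε δ₁]

/-- An active face with `d i x < 0` is positive just before time `0` along every solution
through `x`. [folklore] -/
theorem face_pos_before_of_deriv_neg (hF : IsRegularPolyfacial φ h d)
    (hσ : IsSolutionOn φ σ (Icc (-δ₁) δ₂)) (hδ₁ : 0 < δ₁) (hδ₂ : 0 ≤ δ₂) (hσ0 : σ 0 = x)
    {i : ι} (hi : h i x = 0) (hd : d i x < 0) :
    ∃ ε ∈ Ioc 0 δ₁, ∀ s ∈ Ico (-ε) 0, 0 < h i (σ s) := by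
  set z := σ (-δ₁) with hz
  have hx : φ δ₁ z = x := by
    have := hσ.eq_orbit_left (by linarith) (s := 0) ⟨by linarith, hδ₂⟩
    rw [zero_add] at this; rw [← this, hσ0]
  obtain ⟨ε, hε, hanti⟩ := hF.exists_strictAntiOn i z hδ₁.le (by rwa [hx])
  refine ⟨min ε δ₁, ⟨lt_min hε hδ₁, min_le_right _ _⟩, fun s hs => ?_⟩
  have hs1 : -δ₁ ≤ s := by linarith [hs.1, min_le_right ε δ₁]
  rw [hσ.eq_orbit_left (by linarith) ⟨hs1, by linarith [hs.2]⟩]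
  have hlt := hanti (a := s + δ₁) (b := δ₁) ⟨?_, by linarith [hs.2]⟩
    ⟨max_le hδ₁.le (by linarith), by linarith⟩ (by linarith [hs.2])
  · simpa [hx, hi] using hlt
  · refine max_le (by linarith) ?_
    linarith [hs.1, min_le_left ε δ₁]

/-- An inactive (positive) face is positive just before time `0` along every solution.
[folklore] -/
theorem face_pos_before_of_face_pos (hF : IsRegularPolyfacial φ h d)
    (hσ : IsSolutionOn φ σ (Icc (-δ₁) δ₂)) (hδ₁ : 0 < δ₁) (hδ₂ : 0 ≤ δ₂) (hσ0 : σ 0 = x)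
    {i : ι} (hi : 0 < h i x) : ∃ ε ∈ Ioc 0 δ₁, ∀ s ∈ Ico (-ε) 0, 0 < h i (σ s) := by
  set z := σ (-δ₁) with hz
  have hx : φ δ₁ z = x := by
    have := hσ.eq_orbit_left (by linarith) (s := 0) ⟨by linarith, hδ₂⟩
    rw [zero_add] at this; rw [← this, hσ0]
  have hc : ContinuousWithinAt (fun r => h i (φ r z)) (Ici 0) δ₁ :=
    (hF.continuous_face i).continuousAt.comp_continuousWithinAt
      (hF.isSemiflow.continuousWithinAt_orbit z hδ₁.le)
  have hev : ∀ᶠ r in 𝓝[Ici (0 : ℝ)] δ₁, 0 < h i (φ r z) :=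
    hc (isOpen_Ioi.mem_nhds (by simpa [hx] using hi))
  rw [nhdsWithin, eventually_inf_principal, Metric.eventually_nhds_iff] at hev
  obtain ⟨η, hη, hball⟩ := hev
  refine ⟨min (η / 2) δ₁, ⟨lt_min (by positivity) hδ₁, min_le_right _ _⟩, fun s hs => ?_⟩
  have hs1 : -δ₁ ≤ s := by linarith [hs.1, min_le_right (η / 2) δ₁]
  rw [hσ.eq_orbit_left (by linarith) ⟨hs1, by linarith [hs.2]⟩]
  refine hball ?_ (show (0 : ℝ) ≤ s + δ₁ by linarith)
  rw [Real.dist_eq, abs_lt]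
  constructor <;> linarith [hs.1, hs.2, min_le_left (η / 2) δ₁]

/-- **Backward exit**: if some active face has `d i x > 0`, every solution through `x` is
outside `faceSet h` just before time `0`. [folklore] -/
theorem forall_not_mem_before_of_deriv_pos (hF : IsRegularPolyfacial φ h d)
    (hσ : IsSolutionOn φ σ (Icc (-δ₁) δ₂)) (hδ₁ : 0 < δ₁) (hδ₂ : 0 ≤ δ₂) (hσ0 : σ 0 = x)
    {i : ι} (hi : h i x = 0) (hd : 0 < d i x) :
    ∃ ε ∈ Ioc 0 δ₁, ∀ s ∈ Ico (-ε) 0, σ s ∉ faceSet h := by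
  obtain ⟨ε, hε, hneg⟩ := hF.face_neg_before_of_deriv_pos hσ hδ₁ hδ₂ hσ0 hi hd
  exact ⟨ε, hε, fun s hs hB => (not_le.2 (hneg s hs)) (hB i)⟩

/-- **Backward entrance from the interior**: if `x ∈ faceSet h` and every active face has
`d i x < 0`, every solution through `x` is in the interior of `faceSet h` just before time `0`
(finitely many faces). [folklore] -/
theorem forall_mem_interior_before_of_deriv_neg [Finite ι] (hF : IsRegularPolyfacial φ h d)
    (hσ : IsSolutionOn φ σ (Icc (-δ₁) δ₂)) (hδ₁ : 0 < δ₁) (hδ₂ : 0 ≤ δ₂) (hσ0 : σ 0 = x)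
    (hx : x ∈ faceSet h) (hneg : ∀ i, h i x = 0 → d i x < 0) :
    ∃ ε ∈ Ioc 0 δ₁, ∀ s ∈ Ico (-ε) 0, σ s ∈ interior (faceSet h) := by
  have hall : ∀ᶠ s in 𝓝[<] (0 : ℝ), ∀ i, 0 < h i (σ s) := by
    refine eventually_all.2 fun i => ?_
    rcases (hx i).eq_or_lt with h0 | hlt
    · obtain ⟨ε, hε, hε'⟩ := hF.face_pos_before_of_deriv_neg hσ hδ₁ hδ₂ hσ0 h0.symm
        (hneg i h0.symm)
      exact mem_of_superset (Ico_mem_nhdsLT (by linarith [hε.1])) hε'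
    · obtain ⟨ε, hε, hε'⟩ := hF.face_pos_before_of_face_pos hσ hδ₁ hδ₂ hσ0 hlt
      exact mem_of_superset (Ico_mem_nhdsLT (by linarith [hε.1])) hε'
  obtain ⟨a, ha, hsub⟩ := mem_nhdsLT_iff_exists_Ico_subset.1 hall
  refine ⟨min (-a) δ₁, ⟨lt_min (by simpa using ha) hδ₁, min_le_right _ _⟩, fun s hs => ?_⟩
  refine setOf_forall_face_pos_subset_interior hF.continuous_face (hsub ⟨?_, hs.2⟩)
  linarith [hs.1, min_le_left (-a) δ₁]

end Backward

/-! ### The exit set of a regular polyfacial set -/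

/-- **Conley's exit set of a regular polyfacial set**: `x ∈ B = faceSet h` leaves `B`
immediately iff some active face has `d i x < 0` (closed-set counterpart of Hartman's
computation of the egress set, Lemma 3.1). [cite: Hartman2002, Ch. X §3, Lemma 3.1, p. 280] -/
theorem immediateExitSet_eq [Finite ι] (hF : IsRegularPolyfacial φ h d) :
    immediateExitSet φ (faceSet h) = {x | x ∈ faceSet h ∧ ∃ i, h i x = 0 ∧ d i x < 0} := by
  ext x
  constructor
  · intro hx
    refine ⟨hx.1, ?_⟩
    by_contra hne
    push Not at hne
    have hfr := hF.isSemiflow.immediateExitSet_subset_frontier hx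
    have hpos : ∀ i, h i x = 0 → 0 < d i x := fun i hi =>
      (hF.deriv_ne_zero x hx.1 i hi).symm.lt_of_le (hne i hi)
    obtain ⟨ε, hε, hin⟩ := hF.forall_mem_interior_of_deriv_pos hx.1 hpos
    obtain ⟨t, ht, hout⟩ := hx.2 ε hε
    exact hout (interior_subset (hin t ⟨ht.1, ht.2.le⟩))
  · rintro ⟨hxB, i, hi, hd⟩
    obtain ⟨ε, hε, hout⟩ := hF.forall_not_mem_of_deriv_neg hi hd
    refine ⟨hxB, fun δ hδ => ⟨min (ε / 2) (δ / 2), ⟨by positivity, ?_⟩, hout _ ⟨by positivity, ?_⟩⟩⟩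
    · exact (min_le_right _ _).trans_lt (by linarith)
    · exact (min_le_left _ _).trans (by linarith)

/-- The exit set of a regular polyfacial set is **closed**: by transversality it equals
`B ∩ ⋃ i, {h i = 0} ∩ {d i ≤ 0}`. [folklore] -/
theorem isClosed_immediateExitSet [Finite ι] (hF : IsRegularPolyfacial φ h d) :
    IsClosed (immediateExitSet φ (faceSet h)) := by
  have heq : immediateExitSet φ (faceSet h) =
      faceSet h ∩ ⋃ i, ({x | h i x = 0} ∩ {x | d i x ≤ 0}) := by
    rw [hF.immediateExitSet_eq]
    ext x
    simp only [mem_setOf_eq, mem_inter_iff, mem_iUnion]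
    constructor
    · rintro ⟨hxB, i, hi, hd⟩
      exact ⟨hxB, i, hi, hd.le⟩
    · rintro ⟨hxB, i, hi, hd⟩
      exact ⟨hxB, i, hi, hd.lt_of_ne (hF.deriv_ne_zero x hxB i hi)⟩
  rw [heq]
  exact (isClosed_faceSet hF.continuous_face).inter (isClosed_iUnion_of_finite fun i =>
    (isClosed_eq (hF.continuous_face i) continuous_const).inter
      (isClosed_le (hF.continuous_deriv i) continuous_const))

/-- **Ważewski's retract principle for a regular polyfacial set** of a continuous semiflow
(first-order case): if there is no retraction of `B = {x | ∀ i, 0 ≤ h i x}` onto its exit set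
`B⁻ = {x ∈ B | ∃ i, h i x = 0 ∧ d i x < 0}` (continuous on `B`, into `B⁻`, fixing `B⁻`), then
some `x ∈ B` has `φ t x ∈ B` for all `t ≥ 0` (closed-set / semiflow counterpart of
Ważewski's theorem for `(u, v)`-subsets). [cite: Hartman2002, Ch. X §3, Thm. 3.1, pp. 280–281] -/
theorem exists_forall_mem_of_not_retract [Finite ι] (hF : IsRegularPolyfacial φ h d)
    (hr : ¬ ∃ r : X → X, ContinuousOn r (faceSet h) ∧
      MapsTo r (faceSet h) {x | x ∈ faceSet h ∧ ∃ i, h i x = 0 ∧ d i x < 0} ∧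
        ∀ x ∈ {x | x ∈ faceSet h ∧ ∃ i, h i x = 0 ∧ d i x < 0}, r x = x) :
    ∃ x ∈ faceSet h, ∀ t : ℝ, 0 ≤ t → φ t x ∈ faceSet h := by
  rw [← hF.immediateExitSet_eq] at hr
  exact hF.isSemiflow.exists_forall_mem_of_not_retract (isClosed_faceSet hF.continuous_face)
    hF.isClosed_immediateExitSet hr

end IsRegularPolyfacial

end Literature.Dynamics.ConleyIndex
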